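import Summits.AtomisticToContinuum.FouriersLaw.Theorems.OddSectorIrreversibilityTapLeakBoundKickCone

/-!
# `TapLeakBound` (stmt-AtomisticToContinuum-15159), line `SketchIdeator2`, floor of `stub_kickCone`: window arithmetic

Helper file (`--supports stmt-AtomisticToContinuum-15159`) for crux
P = `Summit.AtomisticToContinuum.FouriersLaw.Theses.OddSectorIrreversibility.TapLeakBound`, registered stub `stub_kickCone`
(C′ `ResampledKickCone`). The stub's LINEAR window `s ≤ a·d` is an open `N`-uniform propagation estimate; its provable FLOOR
(lead c3) is the same resampled-kick cone in the SUBLINEAR window `s⁴ ≤ a (1+d)³`, assembled from the landed deterministic block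
light cone by energy truncation at the box scale `R = (1+d)^{1/4}` (site-energy cap `E = lam R⁴/4 = lam (1+d)/4`). This file holds
the elementary real arithmetic of that choice, with no measure theory:

* `one_le_sqrt_sqrt`, `sqrt_sqrt_pow_four`, `sqrt_sqrt_pow_three_le` — the box scale `R = √(√(1+d))`: `R ≥ 1`, `R⁴ = 1+d`, `R³ ≤ 1+d`;
* `window_of_pow_four_le` — the window: `s⁴ ≤ a(1+d)³` with `a = (16 · 32⁴ · A⁴)⁻¹` and `d ≥ 1` forces `32·A·R·s ≤ d` (and `s ≤ 1+d`),
  the hypothesis of the good-event bound `stub_floorGoodKick` (`A = √(1 + ω₂ + 3 lam + 12 β)`);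
* `exp_three_quarters_le`, `geom_mul_pow_le` — `e^{3/4} ≤ 9/4`, hence `(4/9)^d (1+d)^n ≤ n! e^{3/4} (4/3)^n` for all `d, n`
  (`x^n/n! ≤ eˣ`): the geometric cone factor beats every polynomial loss of the truncation;
* `tail_pow_seven_le`, `tail_pow_twentyeight_le` — the two Markov factors of the bad event at cap `E = lam(1+d)/4`:
  `(2/E)^7 = (8/lam)^7 (1+d)^{-7}` and `(4s/E)^{28} ≤ (2^{16} a/lam⁴)^7 (1+d)^{-7}` on the window;
* `integral_sq_sub_gaussianReal` — `∫ (c - p')² dN(0,T)(p') = c² + T`.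

References: folklore. Nothing here closes the item.
-/

noncomputable section

open MeasureTheory ProbabilityTheory Filter Topology Set Function
open scoped NNReal ENNReal

namespace Summit.AtomisticToContinuum.FouriersLaw.Theorems.OddSectorIrreversibility.TapLeak

/-! ### The box scale `R = (1+d)^{1/4}` -/

/-- `1 ≤ √(√(1+d))`. [folklore] -/
theorem one_le_sqrt_sqrt (d : ℕ) : 1 ≤ Real.sqrt (Real.sqrt (1 + (d : ℝ))) := by
  rw [Real.one_le_sqrt, Real.one_le_sqrt]
  have : (0 : ℝ) ≤ d := Nat.cast_nonneg d
  linarith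

/-- `(√(√(1+d)))⁴ = 1 + d`. [folklore] -/
theorem sqrt_sqrt_pow_four (d : ℕ) : Real.sqrt (Real.sqrt (1 + (d : ℝ))) ^ 4 = 1 + (d : ℝ) := by
  have h0 : (0 : ℝ) ≤ 1 + (d : ℝ) := by positivity
  have h1 : (0 : ℝ) ≤ Real.sqrt (1 + (d : ℝ)) := Real.sqrt_nonneg _
  rw [show (4 : ℕ) = 2 * 2 from rfl, pow_mul, Real.sq_sqrt h1, Real.sq_sqrt h0]

/-- `(√(√(1+d)))² = √(1 + d)`. [folklore] -/
theorem sqrt_sqrt_sq (d : ℕ) : Real.sqrt (Real.sqrt (1 + (d : ℝ))) ^ 2 = Real.sqrt (1 + (d : ℝ)) :=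
  Real.sq_sqrt (Real.sqrt_nonneg _)

/-- `(√(√(1+d)))³ ≤ 1 + d` (`R³ ≤ R⁴` for `R ≥ 1`). [folklore] -/
theorem sqrt_sqrt_pow_three_le (d : ℕ) : Real.sqrt (Real.sqrt (1 + (d : ℝ))) ^ 3 ≤ 1 + (d : ℝ) := by
  calc Real.sqrt (Real.sqrt (1 + (d : ℝ))) ^ 3 ≤ Real.sqrt (Real.sqrt (1 + (d : ℝ))) ^ 4 :=
        pow_le_pow_right₀ (one_le_sqrt_sqrt d) (by norm_num : (3 : ℕ) ≤ 4)
    _ = 1 + (d : ℝ) := sqrt_sqrt_pow_four d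

/-- `(√(√(1+d)))ᵏ ≤ (1 + d)ᵏ` for every `k` (crude: `R ≤ R⁴`). [folklore] -/
theorem sqrt_sqrt_pow_le (d k : ℕ) : Real.sqrt (Real.sqrt (1 + (d : ℝ))) ^ k ≤ (1 + (d : ℝ)) ^ k := by
  refine pow_le_pow_left₀ (Real.sqrt_nonneg _) ?_ k
  calc Real.sqrt (Real.sqrt (1 + (d : ℝ))) = Real.sqrt (Real.sqrt (1 + (d : ℝ))) ^ 1 := (pow_one _).symm
    _ ≤ Real.sqrt (Real.sqrt (1 + (d : ℝ))) ^ 4 := pow_le_pow_right₀ (one_le_sqrt_sqrt d) (by norm_num : (1 : ℕ) ≤ 4)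
    _ = 1 + (d : ℝ) := sqrt_sqrt_pow_four d

/-! ### The window -/

/-- **The sublinear window.** With `a = (16 · 32⁴ · A⁴)⁻¹` (`A ≥ 1`), `R = √(√(1+d))`, `d ≥ 1`, `s ≥ 0`: if `s⁴ ≤ a (1+d)³` then
`32 A R s ≤ d` and `s ≤ 1 + d`. (Fourth powers: `(32ARs)⁴ = 32⁴A⁴(1+d)s⁴ ≤ 32⁴A⁴ a (1+d)⁴ = (1+d)⁴/16 ≤ d⁴`.) [folklore] -/
theorem window_of_pow_four_le {A s : ℝ} (hA : 1 ≤ A) (hs : 0 ≤ s) {d : ℕ} (hd : 1 ≤ d)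
    (hw : s ^ 4 ≤ (16 * 32 ^ 4 * A ^ 4)⁻¹ * (1 + (d : ℝ)) ^ 3) :
    32 * A * Real.sqrt (Real.sqrt (1 + (d : ℝ))) * s ≤ d ∧ s ≤ 1 + (d : ℝ) := by
  set R := Real.sqrt (Real.sqrt (1 + (d : ℝ))) with hR
  have hd1 : (1 : ℝ) ≤ d := by exact_mod_cast hd
  have hd0 : (0 : ℝ) ≤ d := by linarith
  have hA0 : 0 ≤ A := zero_le_one.trans hA
  have hR0 : 0 ≤ R := Real.sqrt_nonneg _
  have hR4 : R ^ 4 = 1 + (d : ℝ) := sqrt_sqrt_pow_four d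
  have hK : (0 : ℝ) < 16 * 32 ^ 4 * A ^ 4 := by positivity
  have h1d : (0 : ℝ) < 1 + d := by linarith
  constructor
  · -- compare fourth powers
    have hlhs0 : 0 ≤ 32 * A * R * s := by positivity
    rw [← pow_le_pow_iff_left₀ hlhs0 hd0 (by norm_num : (4 : ℕ) ≠ 0)]
    have e1 : (32 * A * R * s) ^ 4 = 32 ^ 4 * A ^ 4 * (1 + (d : ℝ)) * s ^ 4 := by
      rw [show (32 * A * R * s) ^ 4 = 32 ^ 4 * A ^ 4 * R ^ 4 * s ^ 4 by ring, hR4]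
    rw [e1]
    have h2 : 32 ^ 4 * A ^ 4 * (1 + (d : ℝ)) * s ^ 4 ≤
        32 ^ 4 * A ^ 4 * (1 + (d : ℝ)) * ((16 * 32 ^ 4 * A ^ 4)⁻¹ * (1 + (d : ℝ)) ^ 3) :=
      mul_le_mul_of_nonneg_left hw (by positivity)
    have e3 : 32 ^ 4 * A ^ 4 * (1 + (d : ℝ)) * ((16 * 32 ^ 4 * A ^ 4)⁻¹ * (1 + (d : ℝ)) ^ 3) =
        (1 + (d : ℝ)) ^ 4 / 16 := by
      field_simp
    have h4 : (1 + (d : ℝ)) ^ 4 / 16 ≤ (d : ℝ) ^ 4 := by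
      rw [div_le_iff₀ (by norm_num : (0 : ℝ) < 16)]
      have : (1 + (d : ℝ)) ≤ 2 * d := by linarith
      calc (1 + (d : ℝ)) ^ 4 ≤ (2 * d) ^ 4 := pow_le_pow_left₀ h1d.le this 4
        _ = (d : ℝ) ^ 4 * 16 := by ring
    exact h2.trans (e3.le.trans h4)
  · -- `s⁴ ≤ (1+d)³ ≤ (1+d)⁴`
    have ha1 : (16 * 32 ^ 4 * A ^ 4)⁻¹ ≤ 1 := by
      rw [inv_le_one_iff₀]
      right
      have : (1 : ℝ) ≤ A ^ 4 := one_le_pow₀ hA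
      nlinarith
    have h1 : s ^ 4 ≤ (1 + (d : ℝ)) ^ 4 := by
      calc s ^ 4 ≤ (16 * 32 ^ 4 * A ^ 4)⁻¹ * (1 + (d : ℝ)) ^ 3 := hw
        _ ≤ 1 * (1 + (d : ℝ)) ^ 3 := mul_le_mul_of_nonneg_right ha1 (by positivity)
        _ ≤ (1 + (d : ℝ)) ^ 4 := by
            rw [one_mul]
            exact pow_le_pow_right₀ (by linarith) (by norm_num)
    exact (pow_le_pow_iff_left₀ hs h1d.le (by norm_num : (4 : ℕ) ≠ 0)).1 h1

/-! ### Geometric beats polynomial -/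

/-- `e^{3/4} ≤ 9/4` (`(e^{3/4})⁴ = e³ < 2.72³ < (9/4)⁴`). [folklore] -/
theorem exp_three_quarters_le : Real.exp (3 / 4) ≤ 9 / 4 := by
  have h4 : Real.exp (3 / 4) ^ 4 = Real.exp 1 ^ 3 := by
    rw [← Real.exp_nat_mul, ← Real.exp_nat_mul]
    norm_num
  have he : Real.exp 1 < 2.7182818286 := Real.exp_one_lt_d9
  have he0 : 0 ≤ Real.exp 1 := (Real.exp_pos 1).le
  have h3 : Real.exp 1 ^ 3 ≤ (9 / 4 : ℝ) ^ 4 := by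
    have : Real.exp 1 ^ 3 ≤ (2.7182818286 : ℝ) ^ 3 := pow_le_pow_left₀ he0 he.le 3
    exact this.trans (by norm_num)
  rw [← pow_le_pow_iff_left₀ (Real.exp_pos _).le (by norm_num : (0 : ℝ) ≤ 9 / 4) (by norm_num : (4 : ℕ) ≠ 0), h4]
  exact h3

/-- **Geometric decay beats polynomial growth**: `(4/9)^d (1+d)^n ≤ n! · e^{3/4} · (4/3)^n` for all `d n : ℕ`
(`(1+d)^n = x^n (4/3)^n` with `x = (3/4)(1+d)`, `x^n ≤ n! eˣ`, and `(4/9) e^{3/4} ≤ 1`). [folklore] -/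
theorem geom_mul_pow_le (d n : ℕ) :
    (4 / 9 : ℝ) ^ d * (1 + (d : ℝ)) ^ n ≤ (n.factorial : ℝ) * Real.exp (3 / 4) * (4 / 3 : ℝ) ^ n := by
  set x : ℝ := 3 / 4 * (1 + (d : ℝ)) with hx
  have hd0 : (0 : ℝ) ≤ d := Nat.cast_nonneg d
  have hx0 : 0 ≤ x := by positivity
  -- `(1 + d)^n = x^n (4/3)^n` and `x^n ≤ n! e^x`
  have h1 : (1 + (d : ℝ)) ^ n = x ^ n * (4 / 3 : ℝ) ^ n := by
    rw [← mul_pow]; congr 1; rw [hx]; ring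
  have h2 : x ^ n ≤ (n.factorial : ℝ) * Real.exp x := by
    have h := Real.pow_div_factorial_le_exp x hx0 n
    rwa [div_le_iff₀ (by positivity : (0 : ℝ) < n.factorial), mul_comm] at h
  -- `e^x = e^{3/4} (e^{3/4})^d` and `(4/9)^d (e^{3/4})^d ≤ 1`
  have h3 : Real.exp x = Real.exp (3 / 4) * Real.exp (3 / 4) ^ d := by
    rw [← Real.exp_nat_mul, ← Real.exp_add]; congr 1; rw [hx]; ring
  have h4 : (4 / 9 : ℝ) ^ d * Real.exp (3 / 4) ^ d ≤ 1 := by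
    rw [← mul_pow]
    refine pow_le_one₀ (by positivity) ?_
    have := exp_three_quarters_le
    nlinarith [Real.exp_pos (3 / 4 : ℝ)]
  have hfe : 0 ≤ (n.factorial : ℝ) * Real.exp (3 / 4) * (4 / 3 : ℝ) ^ n := by positivity
  calc (4 / 9 : ℝ) ^ d * (1 + (d : ℝ)) ^ n = (4 / 9 : ℝ) ^ d * (x ^ n * (4 / 3 : ℝ) ^ n) := by rw [h1]
    _ ≤ (4 / 9 : ℝ) ^ d * ((n.factorial : ℝ) * Real.exp x * (4 / 3 : ℝ) ^ n) := by
        gcongr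
    _ = ((n.factorial : ℝ) * Real.exp (3 / 4) * (4 / 3 : ℝ) ^ n) * ((4 / 9 : ℝ) ^ d * Real.exp (3 / 4) ^ d) := by
        rw [h3]; ring
    _ ≤ ((n.factorial : ℝ) * Real.exp (3 / 4) * (4 / 3 : ℝ) ^ n) * 1 := mul_le_mul_of_nonneg_left h4 hfe
    _ = _ := mul_one _

/-! ### The two Markov factors at cap `E = lam (1+d)/4` -/

/-- `(2/E)^7 = (8/lam)^7 / (1+d)^7` at `E = lam (1+d)/4`. [folklore] -/
theorem tail_pow_seven_eq {lam : ℝ} (hl : 0 < lam) (d : ℕ) :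
    (2 / (lam * (1 + (d : ℝ)) / 4)) ^ 7 = (8 / lam) ^ 7 / (1 + (d : ℝ)) ^ 7 := by
  have hd : (0 : ℝ) < 1 + d := by positivity
  rw [← div_pow]; congr 1
  field_simp
  ring

/-- On the window `s⁴ ≤ a(1+d)³` (`s ≥ 0`): `(4s/E)^{28} ≤ (2^{16} a / lam⁴)^7 / (1+d)^7` at `E = lam (1+d)/4`
(`(4s)⁴/E⁴ = 2^{16} s⁴/(lam⁴ (1+d)⁴) ≤ 2^{16} a/(lam⁴ (1+d))`). [folklore] -/
theorem tail_pow_twentyeight_le {lam a s : ℝ} (hl : 0 < lam) (d : ℕ)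
    (hw : s ^ 4 ≤ a * (1 + (d : ℝ)) ^ 3) :
    (4 * s / (lam * (1 + (d : ℝ)) / 4)) ^ 28 ≤ (2 ^ 16 * a / lam ^ 4) ^ 7 / (1 + (d : ℝ)) ^ 7 := by
  have hd : (0 : ℝ) < 1 + d := by positivity
  have e1 : (4 * s / (lam * (1 + (d : ℝ)) / 4)) ^ 28 = ((4 * s / (lam * (1 + (d : ℝ)) / 4)) ^ 4) ^ 7 := by
    rw [← pow_mul]
  have e2 : (4 * s / (lam * (1 + (d : ℝ)) / 4)) ^ 4 = 2 ^ 16 * s ^ 4 / (lam ^ 4 * (1 + (d : ℝ)) ^ 4) := by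
    field_simp
    ring
  have h3 : 2 ^ 16 * s ^ 4 / (lam ^ 4 * (1 + (d : ℝ)) ^ 4) ≤ 2 ^ 16 * a / lam ^ 4 / (1 + (d : ℝ)) := by
    rw [div_div, div_le_div_iff₀ (by positivity) (by positivity)]
    have : s ^ 4 * (lam ^ 4 * (1 + (d : ℝ))) ≤ a * (1 + (d : ℝ)) ^ 3 * (lam ^ 4 * (1 + (d : ℝ))) :=
      mul_le_mul_of_nonneg_right hw (by positivity)
    nlinarith [this]
  have h0 : 0 ≤ 2 ^ 16 * s ^ 4 / (lam ^ 4 * (1 + (d : ℝ)) ^ 4) := by positivity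
  rw [e1, e2]
  calc (2 ^ 16 * s ^ 4 / (lam ^ 4 * (1 + (d : ℝ)) ^ 4)) ^ 7 ≤ (2 ^ 16 * a / lam ^ 4 / (1 + (d : ℝ))) ^ 7 :=
        pow_le_pow_left₀ h0 h3 7
    _ = (2 ^ 16 * a / lam ^ 4) ^ 7 / (1 + (d : ℝ)) ^ 7 := by rw [div_pow]

/-! ### The Gaussian second moment of the kick -/

/-- `∫ p'² dN(0,T)(p') = T` (`T > 0`). [folklore] -/
theorem integral_sq_gaussianReal {T : ℝ} (hT : 0 < T) :
    ∫ p', p' ^ 2 ∂(gaussianReal 0 (Real.toNNReal T)) = T := by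
  have hvar := variance_id_gaussianReal (μ := (0 : ℝ)) (v := Real.toNNReal T)
  rw [variance_eq_integral measurable_id.aemeasurable] at hvar
  simp only [id_eq, integral_id_gaussianReal, sub_zero] at hvar
  rw [hvar, Real.coe_toNNReal T hT.le]

/-- `p' ↦ p'²` is integrable under `N(0,T)`. [folklore] -/
theorem integrable_sq_gaussianReal (T : ℝ) :
    Integrable (fun p' : ℝ => p' ^ 2) (gaussianReal 0 (Real.toNNReal T)) :=
  (memLp_two_iff_integrable_sq measurable_id.aestronglyMeasurable).1 (memLp_id_gaussianReal 2)

/-- **The kick's second moment**: `∫ (c - p')² dN(0,T)(p') = c² + T` (`T > 0`). [folklore] -/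
theorem integral_sq_sub_gaussianReal {T : ℝ} (hT : 0 < T) (c : ℝ) :
    ∫ p', (c - p') ^ 2 ∂(gaussianReal 0 (Real.toNNReal T)) = c ^ 2 + T := by
  have h1 : Integrable (fun p' : ℝ => p') (gaussianReal 0 (Real.toNNReal T)) :=
    memLp_one_iff_integrable.1 (memLp_id_gaussianReal 1)
  have h2 := integrable_sq_gaussianReal T
  have h3 : Integrable (fun p' : ℝ => (-(2 * c)) * p') (gaussianReal 0 (Real.toNNReal T)) := h1.const_mul _
  have h4 : Integrable (fun p' : ℝ => (-(2 * c)) * p' + p' ^ 2) (gaussianReal 0 (Real.toNNReal T)) := h3.add h2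
  have e : (fun p' : ℝ => (c - p') ^ 2) = fun p' => c ^ 2 + ((-(2 * c)) * p' + p' ^ 2) := by
    funext p'; ring
  have s1 : ∫ p', c ^ 2 + ((-(2 * c)) * p' + p' ^ 2) ∂(gaussianReal 0 (Real.toNNReal T)) =
      (∫ _p' : ℝ, c ^ 2 ∂(gaussianReal 0 (Real.toNNReal T))) +
        ∫ p', ((-(2 * c)) * p' + p' ^ 2) ∂(gaussianReal 0 (Real.toNNReal T)) :=
    integral_add (integrable_const _) h4
  have s2 : ∫ p', ((-(2 * c)) * p' + p' ^ 2) ∂(gaussianReal 0 (Real.toNNReal T)) =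
      (∫ p', (-(2 * c)) * p' ∂(gaussianReal 0 (Real.toNNReal T))) + ∫ p', p' ^ 2 ∂(gaussianReal 0 (Real.toNNReal T)) :=
    integral_add h3 h2
  rw [e, s1, s2, integral_const, probReal_univ, one_smul, integral_const_mul, integral_id_gaussianReal,
    integral_sq_gaussianReal hT]
  ring

/-- `(c - p')²` is `N(0,T)`-integrable. [folklore] -/
theorem integrable_sq_sub_gaussianReal (T c : ℝ) :
    Integrable (fun p' : ℝ => (c - p') ^ 2) (gaussianReal 0 (Real.toNNReal T)) := by
  have h1 : Integrable (fun p' : ℝ => p') (gaussianReal 0 (Real.toNNReal T)) :=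
    memLp_one_iff_integrable.1 (memLp_id_gaussianReal 1)
  have h2 := integrable_sq_gaussianReal T
  have h3 : Integrable (fun p' : ℝ => (-(2 * c)) * p') (gaussianReal 0 (Real.toNNReal T)) := h1.const_mul _
  have h4 : Integrable (fun p' : ℝ => (-(2 * c)) * p' + p' ^ 2) (gaussianReal 0 (Real.toNNReal T)) := h3.add h2
  have h5 : Integrable (fun p' : ℝ => c ^ 2 + ((-(2 * c)) * p' + p' ^ 2)) (gaussianReal 0 (Real.toNNReal T)) :=
    (integrable_const _).add h4
  have e : (fun p' : ℝ => (c - p') ^ 2) = fun p' => c ^ 2 + ((-(2 * c)) * p' + p' ^ 2) := by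
    funext p'; ring
  rw [e]
  exact h5

/-! ### Registered sub-goal of the line (closed form of `window_of_pow_four_le`) -/

/-- **Sub-goal `stub_floorWindow`** (registered on the crux item for this helper file; closed `∀`-form of
`window_of_pow_four_le`): the sublinear window of the floor program. [folklore] -/
theorem stub_floorWindow : ∀ (A s : ℝ), 1 ≤ A → 0 ≤ s → ∀ (d : ℕ), 1 ≤ d → s ^ 4 ≤ (16 * 32 ^ 4 * A ^ 4)⁻¹ * (1 + (d : ℝ)) ^ 3 → 32 * A * Real.sqrt (Real.sqrt (1 + (d : ℝ))) * s ≤ d ∧ s ≤ 1 + (d : ℝ) :=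
  fun _ _ hA hs _ hd hw => window_of_pow_four_le hA hs hd hw

end Summit.AtomisticToContinuum.FouriersLaw.Theorems.OddSectorIrreversibility.TapLeak

end
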